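import Summits.KontsevichZagierPeriods.KontsevichZagierPeriods.Theorems.RootDecompZetaThreeFrontierGZLadderFourPolarP05

/-! # `RootDecompZetaThreeFrontierGZLadderFourPolarP06` — part 6/12 of the mechanical ≤400-line split of `l4_src.lean` (sha256 5cc5a9ee4c47da9a…)
Source: decomp-kz lens-1 g13 Layer4_v1.lean @897236f9 minus the RungFour prelude block (imported from …RungFourPreludeP14); --supports stmt-KontsevichZagierPeriods-27141.
Split by census-1 g10 `gen/splitlean.py`: scopes re-opened with their `open`/`variable`/`set_option` context; mathematics and declaration order unchanged. -/

set_option linter.dupNamespace false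
noncomputable section
set_option linter.dupNamespace false
set_option linter.unusedVariables false
set_option linter.unusedSectionVars false
set_option linter.unusedSimpArgs false
open Set MeasureTheory MvPolynomial
open Literature.NumberTheory.Transcendental
open Summit.KontsevichZagierPeriods.KontsevichZagierPeriods.Theorems.RootDecompZetaThreeFrontierWordMoves
namespace Summit.KontsevichZagierPeriods.KontsevichZagierPeriods.Cruxes.GZNormalFormWThree.GZLadder.OrdFour
open Summit.KontsevichZagierPeriods.KontsevichZagierPeriods.Cruxes.GZNormalFormWThree.GZLadder.RungFour
open Summit.KontsevichZagierPeriods.KontsevichZagierPeriods.Cruxes.GZNormalFormWThree.GZLadder.WlogFour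
open Summit.KontsevichZagierPeriods.KontsevichZagierPeriods.Cruxes.GZNormalFormWThree.GZLadder.MatchFour
open Summit.KontsevichZagierPeriods.KontsevichZagierPeriods.Cruxes.GZNormalFormWThree.GZLadder.GapForm

open Set MeasureTheory MvPolynomial in
open Literature.NumberTheory.Transcendental in
open Summit.KontsevichZagierPeriods.KontsevichZagierPeriods.Theorems.RootDecompZetaThreeFrontierWordMoves in
/-- Auxiliary step `mem_simplex_four_iff` (§W5): mem simplex four iff. [bookkeeping] -/
private theorem mem_simplex_four_iff (t : Fin 4 → ℝ) :
    t ∈ KZ.openOrderedSimplex 4 ↔ 0 < t 3 ∧ t 3 < t 2 ∧ t 2 < t 1 ∧ t 1 < t 0 ∧ t 0 < 1 := by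
  constructor
  · rintro ⟨h0, h1, ha⟩
    exact ⟨h0 3, ha (show (2 : Fin 4) < 3 by decide), ha (show (1 : Fin 4) < 2 by decide),
      ha (show (0 : Fin 4) < 1 by decide), h1 0⟩
  · rintro ⟨h3, h32, h21, h10, h0⟩
    have hsa : StrictAnti t := by
      refine Fin.strictAnti_iff_succ_lt.mpr fun i => ?_
      fin_cases i
      · simpa using h10
      · simpa using h21
      · simpa using h32
    exact ⟨fun i => lt_of_lt_of_le h3 (hsa.antitone (Fin.le_last i)),
      fun i => lt_of_le_of_lt (hsa.antitone (Fin.le_iff_val_le_val.2 (Nat.zero_le _))) h0, hsa⟩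

open Set MeasureTheory MvPolynomial in
open Literature.NumberTheory.Transcendental in
open Summit.KontsevichZagierPeriods.KontsevichZagierPeriods.Theorems.RootDecompZetaThreeFrontierWordMoves in
/-- Auxiliary step `abs_det_of_invol4` (§W4): abs det of invol4. [bookkeeping] -/
private theorem abs_det_of_invol4 {L : (Fin 4 → ℝ) →L[ℝ] (Fin 4 → ℝ)} (h : ∀ w, L (L w) = w) : |L.det| = 1 := by
  have hcomp : (L : (Fin 4 → ℝ) →ₗ[ℝ] (Fin 4 → ℝ)) ∘ₗ (L : (Fin 4 → ℝ) →ₗ[ℝ] (Fin 4 → ℝ)) = LinearMap.id := by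
    apply LinearMap.ext
    intro w
    simp [h]
  have h1 := congrArg LinearMap.det hcomp
  rw [LinearMap.det_comp, LinearMap.det_id] at h1
  have h2 : |LinearMap.det (L : (Fin 4 → ℝ) →ₗ[ℝ] (Fin 4 → ℝ))| ^ 2 = 1 := by
    rw [sq_abs, sq, h1]
  exact (pow_eq_one_iff_of_nonneg (abs_nonneg _) two_ne_zero).1 h2

/-- Auxiliary step `hasFDerivAt_cΨ`: has FDeriv At cΨ. [bookkeeping] -/
theorem hasFDerivAt_cΨ (y : Fin 4 → ℝ) : HasFDerivAt cΨ (cD y) y := by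
  have h0 : HasFDerivAt (fun q : Fin 4 → ℝ => q 0) (Pj4 0) y := hasFDerivAt_apply 0 y
  have h1 : HasFDerivAt (fun q : Fin 4 → ℝ => q 1) (Pj4 1) y := hasFDerivAt_apply 1 y
  have h2 : HasFDerivAt (fun q : Fin 4 → ℝ => q 2) (Pj4 2) y := hasFDerivAt_apply 2 y
  have h3 : HasFDerivAt (fun q : Fin 4 → ℝ => q 3) (Pj4 3) y := hasFDerivAt_apply 3 y
  have c0 : HasFDerivAt (fun q : Fin 4 → ℝ => cΨ q 0) ((ContinuousLinearMap.proj 0).comp (cD y)) y := by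
    refine h3.congr_fderiv ?_
    ext v
    simp [cD_apply, cJ, Matrix.mulVec, dotProduct, Fin.sum_univ_four]
  have c1 : HasFDerivAt (fun q : Fin 4 → ℝ => cΨ q 1) ((ContinuousLinearMap.proj 1).comp (cD y)) y := by
    refine (h3.mul h0).congr_fderiv ?_
    ext v
    simp [cD_apply, cJ, Matrix.mulVec, dotProduct, Fin.sum_univ_four]
  have c2 : HasFDerivAt (fun q : Fin 4 → ℝ => cΨ q 2) ((ContinuousLinearMap.proj 2).comp (cD y)) y := by
    refine ((h3.mul h0).mul h1).congr_fderiv ?_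
    ext v
    simp [cD_apply, cJ, Matrix.mulVec, dotProduct, Fin.sum_univ_four]
    ring
  have c3 : HasFDerivAt (fun q : Fin 4 → ℝ => cΨ q 3) ((ContinuousLinearMap.proj 3).comp (cD y)) y := by
    refine (((h3.mul h0).mul h1).mul h2).congr_fderiv ?_
    ext v
    simp [cD_apply, cJ, Matrix.mulVec, dotProduct, Fin.sum_univ_four]
    ring
  rw [hasFDerivAt_pi']
  intro i
  fin_cases i
  · exact c0
  · exact c1
  · exact c2
  · exact c3

/-- Auxiliary step `cΨ_mem`: cΨ mem. [bookkeeping] -/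
theorem cΨ_mem {y : Fin 4 → ℝ} (hy : y ∈ Cube4) : cΨ y ∈ KZ.openOrderedSimplex 4 := by
  obtain ⟨h0, h01, h1, h11, h2, h21, h3, h31⟩ := hy
  rw [mem_simplex_four_iff, cΨ_zero, cΨ_one, cΨ_two, cΨ_three]
  have h30 : 0 < y 3 * y 0 := mul_pos h3 h0
  have h301 : 0 < y 3 * y 0 * y 1 := mul_pos h30 h1
  exact ⟨mul_pos h301 h2, mul_lt_of_lt_one_right h301 h21, mul_lt_of_lt_one_right h30 h11,
    mul_lt_of_lt_one_right h3 h01, h31⟩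

/-- Auxiliary step `injOn_cΨ`: inj On cΨ. [bookkeeping] -/
theorem injOn_cΨ : InjOn cΨ Cube4 := by
  intro y hy y' hy' h
  have e3 : y 3 = y' 3 := by
    have := congrFun h 0
    rwa [cΨ_zero, cΨ_zero] at this
  have e0 : y 0 = y' 0 := by
    have := congrFun h 1
    rw [cΨ_one, cΨ_one, ← e3] at this
    exact mul_left_cancel₀ hy.2.2.2.2.2.2.1.ne' this
  have e1 : y 1 = y' 1 := by
    have := congrFun h 2
    rw [cΨ_two, cΨ_two, ← e3, ← e0] at this
    exact mul_left_cancel₀ (mul_pos hy.2.2.2.2.2.2.1 hy.1).ne' this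
  have e2 : y 2 = y' 2 := by
    have := congrFun h 3
    rw [cΨ_three, cΨ_three, ← e3, ← e0, ← e1] at this
    exact mul_left_cancel₀ (mul_pos (mul_pos hy.2.2.2.2.2.2.1 hy.1) hy.2.2.1).ne' this
  funext i
  fin_cases i
  · exact e0
  · exact e1
  · exact e2
  · exact e3

/-- Auxiliary step `image_cΨ`: image cΨ. [bookkeeping] -/
theorem image_cΨ : cΨ '' Cube4 = KZ.openOrderedSimplex 4 := by
  ext t
  constructor
  · rintro ⟨y, hy, rfl⟩
    exact cΨ_mem hy
  · intro ht
    obtain ⟨h3, h32, h21, h10, h0⟩ := (mem_simplex_four_iff t).1 ht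
    have ht2 : 0 < t 2 := h3.trans h32
    have ht1 : 0 < t 1 := ht2.trans h21
    have ht0 : 0 < t 0 := ht1.trans h10
    have ht0' : t 0 ≠ 0 := ht0.ne'
    have ht1' : t 1 ≠ 0 := ht1.ne'
    have ht2' : t 2 ≠ 0 := ht2.ne'
    refine ⟨![t 1 / t 0, t 2 / t 1, t 3 / t 2, t 0], ?_, ?_⟩
    · simp only [Cube4, mem_setOf_eq, Matrix.cons_val_zero, Matrix.cons_val_one, Matrix.head_cons, Matrix.cons_val_two,
        Matrix.tail_cons, Matrix.cons_val_three]
      exact ⟨by positivity, by rwa [div_lt_one ht0], by positivity, by rwa [div_lt_one ht1], by positivity,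
        by rwa [div_lt_one ht2], ht0, h0⟩
    · funext i
      fin_cases i <;> simp [cΨ] <;> field_simp

/-- **the vertex blow-up pull-back**: `F` integrable on `Δ₄` ⟹ `y ↦ y₃³y₀²y₁·F(Ψ y)` integrable on the cube -/
theorem integrableOn_cchart {F : (Fin 4 → ℝ) → ℝ} (hF : IntegrableOn F (KZ.openOrderedSimplex 4)) :
    IntegrableOn (fun y => y 3 ^ 3 * y 0 ^ 2 * y 1 * F (cΨ y)) Cube4 := by
  have key := (integrableOn_image_iff_integrableOn_abs_det_fderiv_smul (μ := volume) measurableSet_Cube4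
    (fun y _ => (hasFDerivAt_cΨ y).hasFDerivWithinAt) injOn_cΨ F).1 (by rw [image_cΨ]; exact hF)
  refine key.congr_fun (fun y hy => ?_) measurableSet_Cube4
  have hy0 := hy.1
  have hy1 := hy.2.2.1
  have hy3 := hy.2.2.2.2.2.2.1
  show |(cD y).det| • F (cΨ y) = y 3 ^ 3 * y 0 ^ 2 * y 1 * F (cΨ y); rw [det_cD, abs_neg, abs_of_pos (by positivity), smul_eq_mul]

/-! ### §N3 Coordinate swaps of the cube and the edge / face charts -/

/-- a `C¹` involution `Φ` of the cube with constant derivative of `|det| = 1` transports integrability on the cube -/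
theorem integrableOn_comp_invol_cube {Φ : (Fin 4 → ℝ) → (Fin 4 → ℝ)} {L : (Fin 4 → ℝ) →L[ℝ] (Fin 4 → ℝ)}
    (hd : ∀ x, HasFDerivAt Φ L x) (hL : |L.det| = 1) (hinv : ∀ z, Φ (Φ z) = z) (hmem : ∀ z ∈ Cube4, Φ z ∈ Cube4)
    {F : (Fin 4 → ℝ) → ℝ} (hF : IntegrableOn F Cube4) : IntegrableOn (fun z => F (Φ z)) Cube4 := by
  have himage : Φ '' Cube4 = Cube4 := by
    ext u; constructor
    · rintro ⟨z, hz, rfl⟩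
      exact hmem z hz
    · intro hu
      exact ⟨Φ u, hmem u hu, hinv u⟩
  have key := (integrableOn_image_iff_integrableOn_abs_det_fderiv_smul (μ := volume) measurableSet_Cube4
    (fun x _ => (hd x).hasFDerivWithinAt) (fun a _ b _ h => by
      have := congrArg Φ h
      rwa [hinv, hinv] at this) (fun z => F (Φ z))).2
    (hF.congr_fun (fun p _ => by simp [hL, hinv]) measurableSet_Cube4)
  rwa [himage] at key

/-- the swap `y₀ ↔ y₃` of the cube -/
def sw03 (y : Fin 4 → ℝ) : Fin 4 → ℝ := ![y 3, y 1, y 2, y 0]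
/-- its linear map -/
def sw03L : (Fin 4 → ℝ) →L[ℝ] (Fin 4 → ℝ) := ContinuousLinearMap.pi ![Pj4 3, Pj4 1, Pj4 2, Pj4 0]

/-- Auxiliary step `sw03_zero` (§N3): sw03 zero. [bookkeeping] -/
@[simp] theorem sw03_zero (y : Fin 4 → ℝ) : sw03 y 0 = y 3 := rfl
/-- Auxiliary step `sw03_one` (§N3): sw03 one. [bookkeeping] -/
@[simp] theorem sw03_one (y : Fin 4 → ℝ) : sw03 y 1 = y 1 := rfl
/-- Auxiliary step `sw03_two` (§N3): sw03 two. [bookkeeping] -/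
@[simp] theorem sw03_two (y : Fin 4 → ℝ) : sw03 y 2 = y 2 := rfl
/-- Auxiliary step `sw03_three` (§N3): sw03 three. [bookkeeping] -/
@[simp] theorem sw03_three (y : Fin 4 → ℝ) : sw03 y 3 = y 0 := rfl

/-- Auxiliary step `sw03_eq_L` (§N3): sw03 eq L. [bookkeeping] -/
theorem sw03_eq_L (y : Fin 4 → ℝ) : sw03 y = sw03L y := by
  funext i
  fin_cases i <;> simp [sw03, sw03L]

/-- Auxiliary step `sw03_sw03` (§N3): sw03 sw03. [bookkeeping] -/
theorem sw03_sw03 (y : Fin 4 → ℝ) : sw03 (sw03 y) = y := by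
  funext i
  fin_cases i <;> rfl

/-- Auxiliary step `sw03L_sw03L` (§N3): sw03 L sw03 L. [bookkeeping] -/
theorem sw03L_sw03L (w : Fin 4 → ℝ) : sw03L (sw03L w) = w := by
  rw [← sw03_eq_L, ← sw03_eq_L, sw03_sw03]

/-- Auxiliary step `hasFDerivAt_sw03` (§N3): has FDeriv At sw03. [bookkeeping] -/
theorem hasFDerivAt_sw03 (x : Fin 4 → ℝ) : HasFDerivAt sw03 sw03L x := by
  have e : sw03 = fun z => sw03L z := funext sw03_eq_L
  rw [e]; exact sw03L.hasFDerivAt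

/-- Auxiliary step `mem_Cube4_sw03` (§N3): mem Cube4 sw03. [bookkeeping] -/
theorem mem_Cube4_sw03 {y : Fin 4 → ℝ} (hy : y ∈ Cube4) : sw03 y ∈ Cube4 := by
  obtain ⟨h0, h01, h1, h11, h2, h21, h3, h31⟩ := hy; exact ⟨h3, h31, h1, h11, h2, h21, h0, h01⟩

/-- the swap `y₁ ↔ y₃` of the cube -/
def sw13 (y : Fin 4 → ℝ) : Fin 4 → ℝ := ![y 0, y 3, y 2, y 1]
/-- its linear map -/
def sw13L : (Fin 4 → ℝ) →L[ℝ] (Fin 4 → ℝ) := ContinuousLinearMap.pi ![Pj4 0, Pj4 3, Pj4 2, Pj4 1]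

/-- Auxiliary step `sw13_zero` (§N3): sw13 zero. [bookkeeping] -/
@[simp] theorem sw13_zero (y : Fin 4 → ℝ) : sw13 y 0 = y 0 := rfl
/-- Auxiliary step `sw13_one` (§N3): sw13 one. [bookkeeping] -/
@[simp] theorem sw13_one (y : Fin 4 → ℝ) : sw13 y 1 = y 3 := rfl
/-- Auxiliary step `sw13_two` (§N3): sw13 two. [bookkeeping] -/
@[simp] theorem sw13_two (y : Fin 4 → ℝ) : sw13 y 2 = y 2 := rfl
/-- Auxiliary step `sw13_three` (§N3): sw13 three. [bookkeeping] -/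
@[simp] theorem sw13_three (y : Fin 4 → ℝ) : sw13 y 3 = y 1 := rfl

/-- Auxiliary step `sw13_eq_L` (§N3): sw13 eq L. [bookkeeping] -/
theorem sw13_eq_L (y : Fin 4 → ℝ) : sw13 y = sw13L y := by
  funext i
  fin_cases i <;> simp [sw13, sw13L]

/-- Auxiliary step `sw13_sw13` (§N3): sw13 sw13. [bookkeeping] -/
theorem sw13_sw13 (y : Fin 4 → ℝ) : sw13 (sw13 y) = y := by
  funext i
  fin_cases i <;> rfl

/-- Auxiliary step `sw13L_sw13L` (§N3): sw13 L sw13 L. [bookkeeping] -/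
theorem sw13L_sw13L (w : Fin 4 → ℝ) : sw13L (sw13L w) = w := by
  rw [← sw13_eq_L, ← sw13_eq_L, sw13_sw13]

/-- Auxiliary step `hasFDerivAt_sw13` (§N3): has FDeriv At sw13. [bookkeeping] -/
theorem hasFDerivAt_sw13 (x : Fin 4 → ℝ) : HasFDerivAt sw13 sw13L x := by
  have e : sw13 = fun z => sw13L z := funext sw13_eq_L
  rw [e]; exact sw13L.hasFDerivAt

/-- Auxiliary step `mem_Cube4_sw13` (§N3): mem Cube4 sw13. [bookkeeping] -/
theorem mem_Cube4_sw13 {y : Fin 4 → ℝ} (hy : y ∈ Cube4) : sw13 y ∈ Cube4 := by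
  obtain ⟨h0, h01, h1, h11, h2, h21, h3, h31⟩ := hy; exact ⟨h0, h01, h3, h31, h2, h21, h1, h11⟩

/-- the EDGE CHART `Ψ(sw03 y) = (y₀, y₀y₃, y₀y₃y₁, y₀y₃y₁y₂)`: the face `y₃ = 0` onto the cluster `t₁ = t₂ = t₃ = 0` -/
def eΨ (y : Fin 4 → ℝ) : Fin 4 → ℝ := ![y 0, y 0 * y 3, y 0 * y 3 * y 1, y 0 * y 3 * y 1 * y 2]

/-- Auxiliary step `eΨ_zero` (§N3): eΨ zero. [bookkeeping] -/
@[simp] theorem eΨ_zero (y : Fin 4 → ℝ) : eΨ y 0 = y 0 := rfl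
/-- Auxiliary step `eΨ_one` (§N3): eΨ one. [bookkeeping] -/
@[simp] theorem eΨ_one (y : Fin 4 → ℝ) : eΨ y 1 = y 0 * y 3 := rfl
/-- Auxiliary step `eΨ_two` (§N3): eΨ two. [bookkeeping] -/
@[simp] theorem eΨ_two (y : Fin 4 → ℝ) : eΨ y 2 = y 0 * y 3 * y 1 := rfl
/-- Auxiliary step `eΨ_three` (§N3): eΨ three. [bookkeeping] -/
@[simp] theorem eΨ_three (y : Fin 4 → ℝ) : eΨ y 3 = y 0 * y 3 * y 1 * y 2 := rfl

/-- Auxiliary step `cΨ_sw03` (§N3): cΨ sw03. [bookkeeping] -/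
theorem cΨ_sw03 (y : Fin 4 → ℝ) : cΨ (sw03 y) = eΨ y := by
  funext i
  fin_cases i <;> rfl

/-- Auxiliary step `continuous_eΨ` (§N3): continuous eΨ. [bookkeeping] -/
theorem continuous_eΨ : Continuous eΨ := by
  have e : eΨ = fun y => cΨ (sw03 y) := funext fun y => (cΨ_sw03 y).symm
  rw [e, funext sw03_eq_L]; exact continuous_cΨ.comp sw03L.continuous

/-- Auxiliary step `eΨ_mem` (§N3): eΨ mem. [bookkeeping] -/
theorem eΨ_mem {y : Fin 4 → ℝ} (hy : y ∈ Cube4) : eΨ y ∈ KZ.openOrderedSimplex 4 := by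
  rw [← cΨ_sw03]; exact cΨ_mem (mem_Cube4_sw03 hy)

/-- **the edge blow-up pull-back** -/
theorem integrableOn_echart {F : (Fin 4 → ℝ) → ℝ} (hF : IntegrableOn F (KZ.openOrderedSimplex 4)) :
    IntegrableOn (fun y => y 0 ^ 3 * y 3 ^ 2 * y 1 * F (eΨ y)) Cube4 := by
  have h := integrableOn_comp_invol_cube hasFDerivAt_sw03 (abs_det_of_invol4 sw03L_sw03L) sw03_sw03
    (fun _ hy => mem_Cube4_sw03 hy) (integrableOn_cchart hF)
  refine h.congr_fun (fun y _ => ?_) measurableSet_Cube4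
  show (sw03 y) 3 ^ 3 * (sw03 y) 0 ^ 2 * (sw03 y) 1 * F (cΨ (sw03 y)) = y 0 ^ 3 * y 3 ^ 2 * y 1 * F (eΨ y); rw [sw03_three, sw03_zero, sw03_one, cΨ_sw03]

/-- the FACE CHART `Ψ(sw13 y) = (y₁, y₁y₀, y₁y₀y₃, y₁y₀y₃y₂)`: the face `y₃ = 0` onto the cluster `t₂ = t₃ = 0` -/
def fΨ (y : Fin 4 → ℝ) : Fin 4 → ℝ := ![y 1, y 1 * y 0, y 1 * y 0 * y 3, y 1 * y 0 * y 3 * y 2]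

/-- Auxiliary step `fΨ_zero` (§N3): fΨ zero. [bookkeeping] -/
@[simp] theorem fΨ_zero (y : Fin 4 → ℝ) : fΨ y 0 = y 1 := rfl
/-- Auxiliary step `fΨ_one` (§N3): fΨ one. [bookkeeping] -/
@[simp] theorem fΨ_one (y : Fin 4 → ℝ) : fΨ y 1 = y 1 * y 0 := rfl
/-- Auxiliary step `fΨ_two` (§N3): fΨ two. [bookkeeping] -/
@[simp] theorem fΨ_two (y : Fin 4 → ℝ) : fΨ y 2 = y 1 * y 0 * y 3 := rfl
/-- Auxiliary step `fΨ_three` (§N3): fΨ three. [bookkeeping] -/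
@[simp] theorem fΨ_three (y : Fin 4 → ℝ) : fΨ y 3 = y 1 * y 0 * y 3 * y 2 := rfl

/-- Auxiliary step `cΨ_sw13` (§N3): cΨ sw13. [bookkeeping] -/
theorem cΨ_sw13 (y : Fin 4 → ℝ) : cΨ (sw13 y) = fΨ y := by
  funext i
  fin_cases i <;> rfl

/-- Auxiliary step `continuous_fΨ` (§N3): continuous fΨ. [bookkeeping] -/
theorem continuous_fΨ : Continuous fΨ := by
  have e : fΨ = fun y => cΨ (sw13 y) := funext fun y => (cΨ_sw13 y).symm
  rw [e, funext sw13_eq_L]; exact continuous_cΨ.comp sw13L.continuous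

/-- Auxiliary step `fΨ_mem` (§N3): fΨ mem. [bookkeeping] -/
theorem fΨ_mem {y : Fin 4 → ℝ} (hy : y ∈ Cube4) : fΨ y ∈ KZ.openOrderedSimplex 4 := by
  rw [← cΨ_sw13]; exact cΨ_mem (mem_Cube4_sw13 hy)

/-- **the face blow-up pull-back** -/
theorem integrableOn_fchart {F : (Fin 4 → ℝ) → ℝ} (hF : IntegrableOn F (KZ.openOrderedSimplex 4)) :
    IntegrableOn (fun y => y 1 ^ 3 * y 0 ^ 2 * y 3 * F (fΨ y)) Cube4 := by
  have h := integrableOn_comp_invol_cube hasFDerivAt_sw13 (abs_det_of_invol4 sw13L_sw13L) sw13_sw13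
    (fun _ hy => mem_Cube4_sw13 hy) (integrableOn_cchart hF)
  refine h.congr_fun (fun y _ => ?_) measurableSet_Cube4
  show (sw13 y) 3 ^ 3 * (sw13 y) 0 ^ 2 * (sw13 y) 1 * F (cΨ (sw13 y)) = y 1 ^ 3 * y 0 ^ 2 * y 3 * F (fΨ y); rw [sw13_three, sw13_zero, sw13_one, cΨ_sw13]

/-! ### §N4 Lifts of monomials through the three charts -/

/-- the polynomial with the monomial `e` of `P` replaced by the monomial `f e` (same coefficient) -/
def lift4 (f : (Fin 4 →₀ ℕ) → (Fin 4 →₀ ℕ)) (P : MvPolynomial (Fin 4) ℚ) : MvPolynomial (Fin 4) ℚ :=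
  ∑ e ∈ P.support, MvPolynomial.monomial (f e) (MvPolynomial.coeff e P)

/-- Auxiliary step `aeval_lift4` (§N4): aeval lift4. [bookkeeping] -/
theorem aeval_lift4 (f : (Fin 4 →₀ ℕ) → (Fin 4 →₀ ℕ)) (P : MvPolynomial (Fin 4) ℚ) (y : Fin 4 → ℝ) :
    MvPolynomial.aeval y (lift4 f P) =
      ∑ e ∈ P.support, ((MvPolynomial.coeff e P : ℚ) : ℝ) * (y 0 ^ (f e 0) * y 1 ^ (f e 1) * y 2 ^ (f e 2) * y 3 ^ (f e 3)) := by
  rw [lift4, map_sum]; refine Finset.sum_congr rfl fun e _ => ?_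
  rw [MvPolynomial.aeval_monomial, Finsupp.prod_pow, Fin.prod_univ_four]; simp [eq_ratCast]

/-- Auxiliary step `mem_support_lift4` (§N4): mem support lift4. [bookkeeping] -/
theorem mem_support_lift4 {f : (Fin 4 →₀ ℕ) → (Fin 4 →₀ ℕ)} (hf : Function.Injective f) (P : MvPolynomial (Fin 4) ℚ)
    {e : Fin 4 →₀ ℕ} (he : e ∈ P.support) : f e ∈ (lift4 f P).support := by
  classical
  rw [MvPolynomial.mem_support_iff, lift4, MvPolynomial.coeff_sum,
    Finset.sum_eq_single e (fun e' _ hne => ?_) (fun hne => absurd he hne)]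
  · rw [MvPolynomial.coeff_monomial, if_pos rfl]
    exact MvPolynomial.mem_support_iff.1 he
  · rw [MvPolynomial.coeff_monomial, if_neg (fun h => hne (hf h))]

/-- vertex lift: `t^e · y₃³y₀²y₁` in the chart `Ψ` is `y₀^{e₁+e₂+e₃+2} y₁^{e₂+e₃+1} y₂^{e₃} y₃^{|e|+3}` -/
def vExp4 (e : Fin 4 →₀ ℕ) : Fin 4 →₀ ℕ :=
  Finsupp.single 0 (e 1 + e 2 + e 3 + 2) + Finsupp.single 1 (e 2 + e 3 + 1) + Finsupp.single 2 (e 3) +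
    Finsupp.single 3 (e 0 + e 1 + e 2 + e 3 + 3)

/-- Auxiliary step `vExp4_apply` (§N4): v Exp4 apply. [bookkeeping] -/
theorem vExp4_apply (e : Fin 4 →₀ ℕ) :
    vExp4 e 0 = e 1 + e 2 + e 3 + 2 ∧ vExp4 e 1 = e 2 + e 3 + 1 ∧ vExp4 e 2 = e 3 ∧ vExp4 e 3 = e 0 + e 1 + e 2 + e 3 + 3 := by
  simp [vExp4]

/-- edge lift: `t^e · y₀³y₃²y₁` in the chart `Ψ ∘ sw03` is `y₀^{|e|+3} y₁^{e₂+e₃+1} y₂^{e₃} y₃^{e₁+e₂+e₃+2}` -/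
def eExp4 (e : Fin 4 →₀ ℕ) : Fin 4 →₀ ℕ :=
  Finsupp.single 0 (e 0 + e 1 + e 2 + e 3 + 3) + Finsupp.single 1 (e 2 + e 3 + 1) + Finsupp.single 2 (e 3) +
    Finsupp.single 3 (e 1 + e 2 + e 3 + 2)

/-- Auxiliary step `eExp4_apply` (§N4): e Exp4 apply. [bookkeeping] -/
theorem eExp4_apply (e : Fin 4 →₀ ℕ) :
    eExp4 e 0 = e 0 + e 1 + e 2 + e 3 + 3 ∧ eExp4 e 1 = e 2 + e 3 + 1 ∧ eExp4 e 2 = e 3 ∧ eExp4 e 3 = e 1 + e 2 + e 3 + 2 := by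
  simp [eExp4]

/-- face lift: `t^e · y₁³y₀²y₃` in the chart `Ψ ∘ sw13` is `y₀^{e₁+e₂+e₃+2} y₁^{|e|+3} y₂^{e₃} y₃^{e₂+e₃+1}` -/
def fExp4 (e : Fin 4 →₀ ℕ) : Fin 4 →₀ ℕ :=
  Finsupp.single 0 (e 1 + e 2 + e 3 + 2) + Finsupp.single 1 (e 0 + e 1 + e 2 + e 3 + 3) + Finsupp.single 2 (e 3) +
    Finsupp.single 3 (e 2 + e 3 + 1)

/-- Auxiliary step `fExp4_apply` (§N4): f Exp4 apply. [bookkeeping] -/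
theorem fExp4_apply (e : Fin 4 →₀ ℕ) :
    fExp4 e 0 = e 1 + e 2 + e 3 + 2 ∧ fExp4 e 1 = e 0 + e 1 + e 2 + e 3 + 3 ∧ fExp4 e 2 = e 3 ∧ fExp4 e 3 = e 2 + e 3 + 1 := by
  simp [fExp4]

/-- Auxiliary step `vExp4_injective` (§N4): v Exp4 injective. [bookkeeping] -/
theorem vExp4_injective : Function.Injective vExp4 := by
  intro e e' h; obtain ⟨a0, a1, a2, a3⟩ := vExp4_apply e
  obtain ⟨b0, b1, b2, b3⟩ := vExp4_apply e'; have h0 := DFunLike.congr_fun h 0; have h1 := DFunLike.congr_fun h 1; have h2 := DFunLike.congr_fun h 2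
  have h3 := DFunLike.congr_fun h 3; rw [a0, b0] at h0; rw [a1, b1] at h1; rw [a2, b2] at h2; rw [a3, b3] at h3; have k2 : e 2 = e' 2 := by omega
  have k1 : e 1 = e' 1 := by omega
  have k0 : e 0 = e' 0 := by omega
  ext j; fin_cases j
  · exact k0
  · exact k1
  · exact k2
  · exact h2

/-- Auxiliary step `eExp4_injective` (§N4): e Exp4 injective. [bookkeeping] -/
theorem eExp4_injective : Function.Injective eExp4 := by
  intro e e' h; obtain ⟨a0, a1, a2, a3⟩ := eExp4_apply e
  obtain ⟨b0, b1, b2, b3⟩ := eExp4_apply e'; have h0 := DFunLike.congr_fun h 0; have h1 := DFunLike.congr_fun h 1; have h2 := DFunLike.congr_fun h 2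
  have h3 := DFunLike.congr_fun h 3; rw [a0, b0] at h0; rw [a1, b1] at h1; rw [a2, b2] at h2; rw [a3, b3] at h3; have k2 : e 2 = e' 2 := by omega
  have k1 : e 1 = e' 1 := by omega
  have k0 : e 0 = e' 0 := by omega
  ext j; fin_cases j
  · exact k0
  · exact k1
  · exact k2
  · exact h2

end Summit.KontsevichZagierPeriods.KontsevichZagierPeriods.Cruxes.GZNormalFormWThree.GZLadder.OrdFour
end
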